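/- Copyright: the b2b-balaban cell (near-miss cell 7), T⁴-continuum fan-out, row-NE7b OWNER lineage `t4-ne7b-p1` (gen 101) —
(α)-instance, THE END AT THE TOWER, part 3: the record's per-step display `hw` FROM PRINT's PER-STEP SENTENCES (J4) at the record's
own letters.  Released under the licence of the surrounding project. -/
import Summits.QuantumFields.BalabanUV.T4Continuum.Support.B16HistoryTowerEndDataLWL
import Summits.QuantumFields.BalabanUV.T4Continuum.Support.B16HistoryStepJunction

/-!
# (α)-INSTANCE — THE END AT THE TOWER, part 3: the `hw` SLOT OF `TowerReadDataLWL` FROM [B16] pp. 380–383's PER-STEP SENTENCES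
(`B16StepFactorsPrinted.StepDisplaysAt`) VIA J4 (`B16HistoryStepJunction`), AT THE RECORD's OWN LETTERS

Summits-side support leaf of the T⁴-continuum cell (rung (B)+1 on a FINITE torus only; NOT infinite volume, NOT the mass gap, NOT
Clay; NOT a proof of NE7b — the cell's OWN estimate `T4WeightBudget.RelWeightBound`, NOT PRINTED, NOT PROVED).  [folklore]
composition BY NAME of IR-100-3 (`hwPinned_of_stepDisplaysAt_chain`, leaf-05) with IR-100-1 (A) v2's monotonicity
(`HwPinned.of_le`) at the letters the tower record `TowerReadDataLWL` (part 1, p345321) consumes; two abbreviations, four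
theorems; no `Prop` minted, nothing cited as hypothesis, zero `sorry`.

WHY.  Part 1's record carries run A's per-step display as `hw : HwPinned T 𝒮 sB (sRpin D O Lr p₁ g₀ 𝒮.R) cΛ M (gsOf D g₀) K₀` — the
birth letter `sB` FREE (floored by `hsB : sBsharp O m C g^K j d′ ≤ sB K j d′`), the renewal letter PINNED to the count road's
unrounded `S_h` (`sRpin`, LWL's `hF` right member).  J4 delivers, from print's per-step sentences at the process carriers + the
class junction + p. 380's volume chain, `HwPinned T 𝒮 (sBsharp Dr c) (sRsharp Dr c) cΛ M gs K₀` at print's SHARP letters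
(p. 381 left member ∕ p. 383 after (1.78)).  THIS FILE reads J4's output AT THE RECORD's LETTERS: the runs are the prefix's own
(`runsOf D g₀ K := D.C ⟨K, F.m, g₀ K⟩`, so `(runsOf D g₀ K).flow.g = gsOf D g₀ K` by `rfl`), the birth letter is TAKEN to be print's
sharp one (`sB := sBsharp (runsOf D g₀) c` — then `hsB` is ONE displayed letter inequality `hsBdom`, the count road's booked
`γ₀·m·p₀²·(d′+1)` below print's `γ₀·min{…}·p₀²·(d′+1)`: `m ≤ min{½B₃⁻²A₀², 2A₁², A₁²}` at equal `γ₀, A₀, p₀` tables), and the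
renewal letter is moved from `sRsharp` DOWN to `sRpin` by `HwPinned.of_le` GIVEN ONE displayed letter inequality `hsRdom :
sRpin … K h ≤ sRsharp … K h` (the unrounded `S_h` the count road books is at most print's p. 383 exponent `R(g_h)^{−(d+5)}·p₁(g_h)²`
— the renewal half of M5-3's rounding junction, NEEDS-CONSTANT-shaped: IR-100-1 (B) `B16HistoryStepDisplayValuations.sRprep` ∕
`roundingRoom_renew_prep` is where its valuation lives).  NET: a consumer holding (A1c)'s tower data + `hdisp` + `hclass` + `hchain` +
`hsBdom` + `hsRdom` fills part 1's `sB ∕ hw ∕ hsB` slots BY NAME (`sB := sBsharp (runsOf D g₀) c`, `hw := hw_of_stepDisplays …`,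
`hsB := hsBdom`) and gets the headline from part 2's `continuumYM4Torus_of_towerReadingLWL_fsc`.  After this file the END's
run-A READING-class content is: print's per-step sentences AT THE TOWER's CARRIERS (`hdisp` — [B16] (1.76)–(1.79) per operation,
a PRINTED claim once (A1c) names Bałaban's tower), the class junction `hclass` (Q-J3-3), the volume chain `hchain` (Q-J3-1, p. 380
l. 12–18 in cube-count form), two letter inequalities (`hsBdom`, `hsRdom` — calc's), `H2A`, `hBρ`, (ρ)∕(ρ′), run B's TRUNC rows.
HONEST LIMITS: nothing of Bałaban's is asserted; the five inputs are displayed; NE7b NOT proved; count 0∕9.  HONEST DEPENDENCY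
(cell): continuum YM on T⁴ ⇐ BetaPertH ∧ nine spine estimates (0/9 proved); BetaPertH ⇐ (D1) ∧ (D4) ∧ CAP+tail; G-an2-4 gates
asym, D1 and NE2/3/4.  This file changes none of it.
-/

open Finset MeasureTheory
open Literature.MathematicalPhysics.QuantumFieldTheory.Balaban1983to89
open Literature.MathematicalPhysics.QuantumFieldTheory.Balaban1983to89.B16StepFactorsPrinted
open Literature.MathematicalPhysics.QuantumFieldTheory.Balaban1983to89.B16LargeFieldFactors380 (minConst)
open T4PrintedShapeBanking T4Continuum
open Literature.MathematicalPhysics.QuantumFieldTheory.Balaban1983to89.TreeLength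
open Literature.MathematicalPhysics.QuantumFieldTheory.Balaban1983to89.B16MergeGeometry
open Summit.QuantumFields.BalabanUV.T4Continuum.HistoryConstants
open Summit.QuantumFields.BalabanUV.T4Continuum.HistoryAdmissible
open Summit.QuantumFields.BalabanUV.T4Continuum.HistoryGenealogyExtraction
open Summit.QuantumFields.BalabanUV.T4Continuum.HistoryGenealogyRealise
open Summit.QuantumFields.BalabanUV.T4Continuum.HistoryGenealogyInstantiate
open Summit.QuantumFields.BalabanUV.T4Continuum.B16HistoryIndexedRepr
open Summit.QuantumFields.BalabanUV.T4Continuum.B16HistoryReprChain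
open Summit.QuantumFields.BalabanUV.T4Continuum.B16HistoryReprInstance
open Summit.QuantumFields.BalabanUV.T4Continuum.B16HistoryReprReadCausal
open Summit.QuantumFields.BalabanUV.T4Continuum.B16HistoryStepDisplayPinned
open Summit.QuantumFields.BalabanUV.T4Continuum.B16HistoryStepJunction
open Summit.QuantumFields.BalabanUV.T4Continuum.B16HistoryTowerEndDataLWL
open Summit.QuantumFields.BalabanUV.T4Continuum.HistoryBankingSharpShares (ell)
open Summit.QuantumFields.BalabanUV.T4Continuum.HistoryBankingRoundingUnrounded (sRunr)
open Summit.QuantumFields.BalabanUV.T4Continuum.HistoryBankingVolumeWindowLattice (uvolL)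

namespace Summit.QuantumFields.BalabanUV.T4Continuum.B16HistoryTowerEndPrinted

noncomputable section

/-! ## §1 The prefix's runs as J4's run sequence (abbreviation) -/

section Runs

variable {F : T4Family} {G : Type*} [GaugeGroup G] [MeasurableSpace G] [HaarData G]

/-- **THE PREFIX's RUNS** as J4's run sequence: run `K` tuned at `g₀ K` IS `D.C ⟨K, F.m, g₀ K⟩ : B16.RunData`.  An abbreviation.
[folklore] -/
@[reducible] def runsOf (D : FiniteEpsData F G) (g₀ : ℕ → ℝ) : ℕ → B16.RunData := fun K => D.C ⟨K, F.m, g₀ K⟩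

/-- the runs' couplings ARE part 1's `gsOf` (by `rfl`) [folklore] -/
theorem flow_runsOf (D : FiniteEpsData F G) (g₀ : ℕ → ℝ) (K : ℕ) : (runsOf D g₀ K).flow.g = gsOf D g₀ K := rfl

end Runs

/-! ## §2 The record's `hw` slot from print's per-step sentences, at the record's letters -/

section Junction

variable {F : T4Family} {G : Type*} [GaugeGroup G] [MeasurableSpace G] [HaarData G]
  (D : FiniteEpsData F G) (O : PrintedO1s) (Lr : ℝ) (p₁ : ℕ) (g₀ : ℕ → ℝ)
  {P : Type} {d : ℕ} {X : ℕ → ℕ → Type} {𝒢 : (K j : ℕ) → GoodClass (X K j)}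
  (T : (K : ℕ) → Tower P (X K) (𝒢 K)) (𝒮 : StepReading P d) (c : B16StepFactorsPrinted.Consts)
  (Xs : (K j : ℕ) → (Fin j → P) → StepData d P) (cΛ M : ℝ)

/-- **PART 1's `hw` SLOT FROM J4, CORE FORM** (the volume side displayed as J4's `hvol`): print's per-step sentences at the process
carriers of the prefix's runs (`hdisp`), the `=` class junction (`hclass`), the volume domination (`hvol`) and ONE renewal-letter
inequality (`hsRdom`: the count road's unrounded `S_h` is at most print's p. 383 exponent) give
`HwPinned T 𝒮 (sBsharp (runsOf D g₀) c) (sRpin D O Lr p₁ g₀ 𝒮.R) cΛ M (gsOf D g₀) K₀` — the type of `TowerReadDataLWL.hw` at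
`sB := sBsharp (runsOf D g₀) c`.  `= (hwPinned_of_stepDisplaysAt …).of_le le_rfl hsRdom le_rfl`. [folklore] -/
theorem hw_of_stepDisplays_of_hvol {K₀ : ℕ} (hc : 0 ≤ cΛ) (hM : 0 ≤ M) (hℓ : ∀ K j, j ≤ K → 0 ≤ ell (gsOf D g₀ K) j)
    (hdisp : ∀ K, K₀ ≤ K → ∀ (j : ℕ) (g : Fin j → P),
      StepDisplaysAt (runsOf D g₀ K) j (carriersOf T 𝒮 (runsOf D g₀ K) K j g (Xs K j g)) c)
    (hclass : ∀ K, K₀ ≤ K → ∀ (j : ℕ) (g : Fin j → P) (p : P),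
      ∀ x ∈ (𝒮.runPartial K (j + 1) (Fin.snoc g p)).histM.newPairs (j + 1),
        (Xs K j g).dC p x = (𝒮.κ K ((𝒮.runPartial K (j + 1) (Fin.snoc g p)).histM.newAt (j + 1) x) : ℝ))
    (hvol : ∀ K, K₀ ≤ K → ∀ (j : ℕ) (g : Fin j → P) (p : P),
      (Xs K j g).gInt p * (Xs K j g).aInt p * (Xs K j g).vfac p ≤
        ∏ cc ∈ (𝒮.runPartial K (j + 1) (Fin.snoc g p)).histM.comp (j + 1),
          ΛexpL cΛ M d (gsOf D g₀) 𝒮.R K (j + 1) ^ (cc.2).card)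
    (hsRdom : ∀ K h, sRpin D O Lr p₁ g₀ 𝒮.R K h ≤ sRsharp (runsOf D g₀) c K h) :
    HwPinned T 𝒮 (sBsharp (runsOf D g₀) c) (sRpin D O Lr p₁ g₀ 𝒮.R) cΛ M (gsOf D g₀) K₀ :=
  (hwPinned_of_stepDisplaysAt T 𝒮 (runsOf D g₀) c Xs cΛ M (gsOf D g₀) hc hM hℓ hdisp hclass hvol).of_le
    (fun _ _ _ => le_rfl) hsRdom le_rfl hM hℓ hc

/-- **PART 1's `hw` SLOT FROM J4 + J4.1** (the volume side from p. 380's chain in cube-count form, `hchain`): as the core form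
with `hvol` discharged by `B16HistoryStepJunction.hvol_of_chain` from (V) + (I) + `hchain`. [folklore] -/
theorem hw_of_stepDisplays {K₀ : ℕ} (hc : 0 ≤ cΛ) (hM : 0 ≤ M) (hℓ : ∀ K j, j ≤ K → 0 ≤ ell (gsOf D g₀ K) j)
    (hdisp : ∀ K, K₀ ≤ K → ∀ (j : ℕ) (g : Fin j → P),
      StepDisplaysAt (runsOf D g₀ K) j (carriersOf T 𝒮 (runsOf D g₀ K) K j g (Xs K j g)) c)
    (hclass : ∀ K, K₀ ≤ K → ∀ (j : ℕ) (g : Fin j → P) (p : P),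
      ∀ x ∈ (𝒮.runPartial K (j + 1) (Fin.snoc g p)).histM.newPairs (j + 1),
        (Xs K j g).dC p x = (𝒮.κ K ((𝒮.runPartial K (j + 1) (Fin.snoc g p)).histM.newAt (j + 1) x) : ℝ))
    (hchain : ∀ K, K₀ ≤ K → ∀ (j : ℕ) (g : Fin j → P) (p : P),
      c.C' * (Xs K j g).volZΩ p + c.C380 * Real.log ((gsOf D g₀ K (j + 1)) ^ 2)⁻¹ * (Xs K j g).volZ p ≤
        uvolL cΛ M d (gsOf D g₀ K) (𝒮.R K) K (j + 1) *
          ∑ cc ∈ (𝒮.runPartial K (j + 1) (Fin.snoc g p)).histM.comp (j + 1), ((cc.2).card : ℝ))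
    (hsRdom : ∀ K h, sRpin D O Lr p₁ g₀ 𝒮.R K h ≤ sRsharp (runsOf D g₀) c K h) :
    HwPinned T 𝒮 (sBsharp (runsOf D g₀) c) (sRpin D O Lr p₁ g₀ 𝒮.R) cΛ M (gsOf D g₀) K₀ :=
  (hwPinned_of_stepDisplaysAt_chain T 𝒮 (runsOf D g₀) c Xs cΛ M (gsOf D g₀) hc hM hℓ hdisp hclass hchain).of_le
    (fun _ _ _ => le_rfl) hsRdom le_rfl hM hℓ hc

/-- **… WITH THE CLASS JUNCTION IN ITS `≤` FORM** (the cell's class of a new region at most print's linear size, `hclassle`; needs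
print's sign `0 ≤ γ₀`), the volume side as `hvol`. [folklore] -/
theorem hw_of_stepDisplays_le {K₀ : ℕ} (hc : 0 ≤ cΛ) (hM : 0 ≤ M) (hℓ : ∀ K j, j ≤ K → 0 ≤ ell (gsOf D g₀ K) j)
    (hγ : 0 ≤ c.γ₀)
    (hdisp : ∀ K, K₀ ≤ K → ∀ (j : ℕ) (g : Fin j → P),
      StepDisplaysAt (runsOf D g₀ K) j (carriersOf T 𝒮 (runsOf D g₀ K) K j g (Xs K j g)) c)
    (hclassle : ∀ K, K₀ ≤ K → ∀ (j : ℕ) (g : Fin j → P) (p : P),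
      ∀ x ∈ (𝒮.runPartial K (j + 1) (Fin.snoc g p)).histM.newPairs (j + 1),
        (𝒮.κ K ((𝒮.runPartial K (j + 1) (Fin.snoc g p)).histM.newAt (j + 1) x) : ℝ) ≤ (Xs K j g).dC p x)
    (hvol : ∀ K, K₀ ≤ K → ∀ (j : ℕ) (g : Fin j → P) (p : P),
      (Xs K j g).gInt p * (Xs K j g).aInt p * (Xs K j g).vfac p ≤
        ∏ cc ∈ (𝒮.runPartial K (j + 1) (Fin.snoc g p)).histM.comp (j + 1),
          ΛexpL cΛ M d (gsOf D g₀) 𝒮.R K (j + 1) ^ (cc.2).card)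
    (hsRdom : ∀ K h, sRpin D O Lr p₁ g₀ 𝒮.R K h ≤ sRsharp (runsOf D g₀) c K h) :
    HwPinned T 𝒮 (sBsharp (runsOf D g₀) c) (sRpin D O Lr p₁ g₀ 𝒮.R) cΛ M (gsOf D g₀) K₀ :=
  (hwPinned_of_stepDisplaysAt_le T 𝒮 (runsOf D g₀) c Xs cΛ M (gsOf D g₀) hc hM hℓ hγ hdisp hclassle hvol).of_le
    (fun _ _ _ => le_rfl) hsRdom le_rfl hM hℓ hc

end Junction

/-! ## §3 The birth-letter floor `hsB` of part 1 at `sB := sBsharp (runsOf D g₀) c` is ONE letter inequality -/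

section BirthFloor

variable {F : T4Family} {G : Type*} [GaugeGroup G] [MeasurableSpace G] [HaarData G]

/-- **PART 1's `hsB` SLOT AT `sB := sBsharp (runsOf D g₀) c` FROM THE LETTER TABLES**: if print's constants record `c` and the
count road's `O`, `C` agree on `γ₀`, `A₀`, `p₀` and the birth-floor mass letter `m` is at most print's p. 381 min-constant
`min{½B₃⁻²A₀², 2A₁², A₁²}` (with part 1's `hm : A₁² ≤ m` this forces `m = min{…} = A₁²`, the ledger relation of
`B16LargeFieldFactors380.min_eq_A1sq`), and `0 ≤ γ₀`, then `sBsharp O m C (gsOf D g₀ K) j d′ ≤ sBsharp (runsOf D g₀) c K j d′`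
for all `K j d′` — part 1's `hsB` verbatim. [folklore] -/
theorem hsB_of_tables (D : FiniteEpsData F G) (g₀ : ℕ → ℝ) (O : PrintedO1s) (m : ℝ) (C : T4PrintedShapeBanking.Consts)
    (c : B16StepFactorsPrinted.Consts) (hγ : c.γ₀ = O.γ₀) (hA : c.A₀ = C.A₀) (hp : c.p₀ = C.p₀) (hγ0 : 0 ≤ O.γ₀)
    (hm : m ≤ minConst c.B₃ c.A₀ c.A₁) (K j d' : ℕ) :
    HistoryBankingSharpShares.sBsharp O m C (gsOf D g₀ K) j d' ≤ sBsharp (runsOf D g₀) c K j d' := by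
  unfold HistoryBankingSharpShares.sBsharp B16HistoryStepJunction.sBsharp
  rw [hγ, hA, hp]
  have h1 : 0 ≤ O.γ₀ * p0Profile C.A₀ C.p₀ (gsOf D g₀ K j) ^ 2 * ((d' : ℝ) + 1) := by positivity
  have hA' : m ≤ minConst c.B₃ C.A₀ c.A₁ := hA ▸ hm
  nlinarith [mul_le_mul_of_nonneg_left hA' h1]

end BirthFloor

/-! ## §5 ERRATUM (v1.2, RULING R-ne7bp1-g101-4) AND THE SHARP ROAD

**§2's three theorems `hw_of_stepDisplays_of_hvol` ∕ `hw_of_stepDisplays` ∕ `hw_of_stepDisplays_le` (v1.1, kept byte-identical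
under the append-only rule) DISPLAY `hsRdom : ∀ K h, sRpin … K h ≤ sRsharp … K h` — AN UNSATISFIABLE HYPOTHESIS along every tower
family with `R_h` unbounded; DO NOT CONSUME THEM.**  Located objection π-gapsne6-g4-1 (pub-balaban-gaps ne6 g4, journal l.48387 ∕
l.48404, kernel-checked `not_forall_sRunr_le_rounded`), UPHELD by the owner: [B16] p. 383's display after (1.78) reads
«exp(−½γ₀[6(d+3)(100M(L+1)N^{β₀}R_j)^{d+2}]⁻¹A₁²p₁²(g_j)) < exp(−R_j^{−d−5}p₁²(g_j))», i.e. the ROUNDED exponent `sRsharp` (J4's (P))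
is SMALLER than the sharp `S_h = sRpin` (the count road's letter; `HistoryBankingRoundingUnrounded.sRsharp_le_sRunr`), so
`sRpin ≤ sRsharp` forces `γ₀A₁²R_h² ≤ 12(d+3)(100M(Lr+1))^{d+2}` — a uniform bound on `R_h`, false as `g₀ K → 0`.  (A)'s
`HwPinned.of_le` WEAKENS letters only; a display at the rounded letter cannot be moved to the sharp one.  THE REPAIR (the refuter's
(a) for σ-END-R1): read the preparatory factor AT PRINT's SHARP FORM directly.  §5 `hwPinned_of_displays` = J4's junction proof at
FREE letters `sB`, `sR` (renewal bound a HYPOTHESIS at `fRexp sR K j` instead of (P)); §6 `hw_of_stepDisplaysSharp(_of_hvol)`: (Y)(F)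
+ the class junction from `StepDisplaysAt` (J4's reading) and ONE displayed SHARP preparatory sentence **`hprepS`: every preparatory
factor of a part renewed by the level-`j` operation of run `K` lies in `[0, exp(−sRpin D O Lr p₁ g₀ 𝒮.R K j)]`** (p. 383's LEFT member
at the count road's letter, `N^{β₀} ↦ R_j^{β₀}`, print's `R(g_j) ↦` the reading's `R_j`; its Literature twin (P♯)
`B16StepFactorsPrepSharp.PrepSharpAt` — pub-balaban-gaps ne6 g4, journal l.48370 — gives it at the tower's carriers modulo the letter
tables) ⟹ `HwPinned T 𝒮 (sBsharp (runsOf D g₀) c) (sRpin D O Lr p₁ g₀ 𝒮.R) cΛ M (gsOf D g₀) K₀` = the type of `TowerReadDataLWL.hw`, NO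
letter weakened or strengthened, NO `hsRdom`.  A consumer fills part 1's `sB ∕ hw ∕ hsB` with `sBsharp (runsOf D g₀) c ∕
hw_of_stepDisplaysSharp … ∕ hsB_of_tables …`. -/

section Generic

variable {P : Type} {d : ℕ} {X : ℕ → ℕ → Type} {𝒢 : (K j : ℕ) → GoodClass (X K j)}
  (T : (K : ℕ) → Tower P (X K) (𝒢 K)) (𝒮 : StepReading P d) (Xs : (K j : ℕ) → (Fin j → P) → StepData d P)
  (sB : ℕ → ℕ → ℕ → ℝ) (sR : ℕ → ℕ → ℝ) (cΛ M : ℝ) (gs : ℕ → ℕ → ℝ)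

/-- **J4's JUNCTION AT FREE LETTERS.**  If, for every run `K ≥ K₀`, step `j`, prefix `g` and choice `p`, (Y) the unit weight of
the one-step map is at most `gInt·aInt·vfac · Π_{new-region pairs} bfac · Π_{renewed-part pairs} lfPrep` (IR-100-2's first conjunct
at the process carriers), every `bfac` of a new-region pair lies in `[0, fBexp sB K (j+1) (κ n) n]` for its region `n`, every
`lfPrep` of a renewed-part pair lies in `[0, fRexp sR K j]`, and the volume side is at most the per-cube costs of the level the step
forms, then `HwPinned T 𝒮 sB sR cΛ M gs K₀`.  (= `B16HistoryStepJunction.hwPinned_of_stepDisplaysAt_of_bfac_le`'s proof with the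
renewal bound a HYPOTHESIS instead of (P); `HistoryGenealogyStepPairs.le_prod_levelShape` at level `j+1`.) [folklore] -/
theorem hwPinned_of_displays {K₀ : ℕ} (hc : 0 ≤ cΛ) (hM : 0 ≤ M) (hℓ : ∀ K j, j ≤ K → 0 ≤ ell (gs K) j)
    (hY : ∀ K, K₀ ≤ K → ∀ (j : ℕ) (g : Fin j → P) (p : P) (x : X K (j + 1)),
      ((T K).op j g p).T (fun _ => 1) x ≤
        (Xs K j g).gInt p * (Xs K j g).aInt p * (Xs K j g).vfac p *
          (∏ y ∈ (𝒮.runPartial K (j + 1) (Fin.snoc g p)).histM.newPairs (j + 1), (Xs K j g).bfac p y) *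
            ∏ y ∈ (𝒮.runPartial K (j + 1) (Fin.snoc g p)).histM.rnwPairs
              (𝒮.runPartial K (j + 1) (Fin.snoc g p)).rnwM (j + 1), (Xs K j g).lfPrep p y)
    (hbfac : ∀ K, K₀ ≤ K → ∀ (j : ℕ) (g : Fin j → P) (p : P),
      ∀ y ∈ (𝒮.runPartial K (j + 1) (Fin.snoc g p)).histM.newPairs (j + 1),
        0 ≤ (Xs K j g).bfac p y ∧ (Xs K j g).bfac p y ≤
          fBexp sB K (j + 1) (𝒮.κ K ((𝒮.runPartial K (j + 1) (Fin.snoc g p)).histM.newAt (j + 1) y))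
            ((𝒮.runPartial K (j + 1) (Fin.snoc g p)).histM.newAt (j + 1) y))
    (hprep : ∀ K, K₀ ≤ K → ∀ (j : ℕ) (g : Fin j → P) (p : P),
      ∀ y ∈ (𝒮.runPartial K (j + 1) (Fin.snoc g p)).histM.rnwPairs (𝒮.runPartial K (j + 1) (Fin.snoc g p)).rnwM (j + 1),
        0 ≤ (Xs K j g).lfPrep p y ∧ (Xs K j g).lfPrep p y ≤ fRexp sR K j)
    (hvol : ∀ K, K₀ ≤ K → ∀ (j : ℕ) (g : Fin j → P) (p : P),
      (Xs K j g).gInt p * (Xs K j g).aInt p * (Xs K j g).vfac p ≤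
        ∏ cc ∈ (𝒮.runPartial K (j + 1) (Fin.snoc g p)).histM.comp (j + 1), ΛexpL cΛ M d gs 𝒮.R K (j + 1) ^ (cc.2).card) :
    HwPinned T 𝒮 sB sR cΛ M gs K₀ := by
  intro K hK j g p x
  set J := 𝒮.runPartial K (j + 1) (Fin.snoc g p) with hJ
  have h1 := hY K hK j g p x
  have hb0 : ∀ y ∈ J.histM.newPairs (j + 1), 0 ≤ (Xs K j g).bfac p y := fun y hy => (hbfac K hK j g p y hy).1
  have hl0 : ∀ y ∈ J.histM.rnwPairs J.rnwM (j + 1), 0 ≤ (Xs K j g).lfPrep p y := fun y hy => (hprep K hK j g p y hy).1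
  have hB0 : 0 ≤ ∏ y ∈ J.histM.newPairs (j + 1), (Xs K j g).bfac p y := Finset.prod_nonneg hb0
  have hL0 : 0 ≤ ∏ y ∈ J.histM.rnwPairs J.rnwM (j + 1), (Xs K j g).lfPrep p y := Finset.prod_nonneg hl0
  have hw0 : 0 ≤ 𝒮.wStep (fBexp sB) (fRexp sR) (ΛexpL cΛ M d gs 𝒮.R) K j g p :=
    𝒮.wStep_nonneg _ _ _ (fBexp_nonneg _) (fRexp_nonneg _) (one_le_ΛexpL cΛ M gs 𝒮.R hc hM hℓ) K j g p
  by_cases hA0 : 0 ≤ (Xs K j g).gInt p * (Xs K j g).aInt p * (Xs K j g).vfac p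
  swap
  · -- degenerate branch: a negative volume-side constant makes (Y)'s right member non-positive
    have hneg : (Xs K j g).gInt p * (Xs K j g).aInt p * (Xs K j g).vfac p *
        (∏ y ∈ J.histM.newPairs (j + 1), (Xs K j g).bfac p y) *
          ∏ y ∈ J.histM.rnwPairs J.rnwM (j + 1), (Xs K j g).lfPrep p y ≤ 0 := by
      have hBL := mul_nonneg hB0 hL0
      nlinarith [hBL, lt_of_not_ge hA0]
    exact (h1.trans hneg).trans hw0
  -- main branch: regroup by `le_prod_levelShape` at level `j + 1`
  have hcls : ∀ n, J.histM.cls n = 𝒮.κ K n := fun _ => rfl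
  have hb : ∀ y ∈ J.histM.newPairs (j + 1), (Xs K j g).bfac p y ≤
      fBexp sB K (j + 1) (J.histM.cls (J.histM.newAt (j + 1) y)) (J.histM.newAt (j + 1) y) := by
    intro y hy
    rw [hcls]
    exact (hbfac K hK j g p y hy).2
  have hl : ∀ y ∈ J.histM.rnwPairs J.rnwM (j + 1), (Xs K j g).lfPrep p y ≤ fRexp sR K (j + 1 - 1) := by
    intro y hy
    rw [Nat.add_sub_cancel]
    exact (hprep K hK j g p y hy).2
  have key := J.histM.le_prod_levelShape J.rnwM (j + 1) (fun cc => ΛexpL cΛ M d gs 𝒮.R K (j + 1) ^ (cc.2).card)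
    (fun d' n => fBexp sB K (j + 1) d' n) (fRexp sR K) J.histM.cls h1 hA0 (hvol K hK j g p) hb0 hb hl0 hl
  -- the right member is `wStep` by definition
  unfold StepReading.wStep lf
  exact key

end Generic

/-! ## §6 The record's `hw` slot with the preparatory factor AT THE SHARP LETTER `sRpin` (no `hsRdom`) -/

section JunctionSharp

variable {F : T4Family} {G : Type*} [GaugeGroup G] [MeasurableSpace G] [HaarData G]
  (D : FiniteEpsData F G) (O : PrintedO1s) (Lr : ℝ) (p₁ : ℕ) (g₀ : ℕ → ℝ)
  {P : Type} {d : ℕ} {X : ℕ → ℕ → Type} {𝒢 : (K j : ℕ) → GoodClass (X K j)}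
  (T : (K : ℕ) → Tower P (X K) (𝒢 K)) (𝒮 : StepReading P d) (c : B16StepFactorsPrinted.Consts)
  (Xs : (K j : ℕ) → (Fin j → P) → StepData d P) (cΛ M : ℝ)

/-- **PART 1's `hw` SLOT, THE PREPARATORY FACTOR AT PRINT's SHARP FORM** (volume side displayed as J4's `hvol`): print's per-step
sentences at the process carriers of the prefix's runs (`hdisp` — its conjuncts (Y) and (F) are used; the ROUNDED (P) is NOT), the
`=` class junction (`hclass`), the volume domination (`hvol`), and the SHARP preparatory sentence at the count road's letter
(`hprepS`: every preparatory factor of a part renewed by the level-`j` operation of run `K` lies in `[0, exp(−sRpin … K j)]` — [B16]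
p. 383, the display after (1.78), LEFT member, with `N^{β₀} ↦ R_j^{β₀}`, print's `R(g_j) ↦` the reading's `R_j`) give
`HwPinned T 𝒮 (sBsharp (runsOf D g₀) c) (sRpin D O Lr p₁ g₀ 𝒮.R) cΛ M (gsOf D g₀) K₀` — THE TYPE OF `TowerReadDataLWL.hw` at
`sB := sBsharp (runsOf D g₀) c`.  No letter is weakened or strengthened. [folklore] -/
theorem hw_of_stepDisplaysSharp_of_hvol {K₀ : ℕ} (hc : 0 ≤ cΛ) (hM : 0 ≤ M)
    (hℓ : ∀ K j, j ≤ K → 0 ≤ ell (gsOf D g₀ K) j)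
    (hdisp : ∀ K, K₀ ≤ K → ∀ (j : ℕ) (g : Fin j → P),
      StepDisplaysAt (runsOf D g₀ K) j (carriersOf T 𝒮 (runsOf D g₀ K) K j g (Xs K j g)) c)
    (hclass : ∀ K, K₀ ≤ K → ∀ (j : ℕ) (g : Fin j → P) (p : P),
      ∀ x ∈ (𝒮.runPartial K (j + 1) (Fin.snoc g p)).histM.newPairs (j + 1),
        (Xs K j g).dC p x = (𝒮.κ K ((𝒮.runPartial K (j + 1) (Fin.snoc g p)).histM.newAt (j + 1) x) : ℝ))
    (hprepS : ∀ K, K₀ ≤ K → ∀ (j : ℕ) (g : Fin j → P) (p : P),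
      ∀ y ∈ (𝒮.runPartial K (j + 1) (Fin.snoc g p)).histM.rnwPairs (𝒮.runPartial K (j + 1) (Fin.snoc g p)).rnwM (j + 1),
        0 ≤ (Xs K j g).lfPrep p y ∧ (Xs K j g).lfPrep p y ≤ Real.exp (-(sRpin D O Lr p₁ g₀ 𝒮.R K j)))
    (hvol : ∀ K, K₀ ≤ K → ∀ (j : ℕ) (g : Fin j → P) (p : P),
      (Xs K j g).gInt p * (Xs K j g).aInt p * (Xs K j g).vfac p ≤
        ∏ cc ∈ (𝒮.runPartial K (j + 1) (Fin.snoc g p)).histM.comp (j + 1),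
          ΛexpL cΛ M d (gsOf D g₀) 𝒮.R K (j + 1) ^ (cc.2).card) :
    HwPinned T 𝒮 (sBsharp (runsOf D g₀) c) (sRpin D O Lr p₁ g₀ 𝒮.R) cΛ M (gsOf D g₀) K₀ := by
  refine hwPinned_of_displays T 𝒮 Xs (sBsharp (runsOf D g₀) c) (sRpin D O Lr p₁ g₀ 𝒮.R) cΛ M (gsOf D g₀) hc hM hℓ
    (fun K hK j g p x => (hdisp K hK j g).1 p x) (fun K hK j g p y hy => ?_) hprepS hvol
  have h := (hdisp K hK j g).2.2.1 p y hy
  refine ⟨h.2.1, ?_⟩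
  have h' := h.2.2
  rw [carriersOf_dC, hclass K hK j g p y hy] at h'
  rw [fBexp_sBsharp]
  exact h'

/-- **PART 1's `hw` SLOT, THE PREPARATORY FACTOR AT PRINT's SHARP FORM, VOLUME SIDE FROM p. 380's CHAIN** (`hchain`, cube-count form;
J4.1 `hvol_of_chain` by name).  The three displayed inputs `hdisp`∕`hclass`∕`hchain` are J4's; `hprepS` is the sharp preparatory
sentence at the count road's letter. [folklore] -/
theorem hw_of_stepDisplaysSharp {K₀ : ℕ} (hc : 0 ≤ cΛ) (hM : 0 ≤ M) (hℓ : ∀ K j, j ≤ K → 0 ≤ ell (gsOf D g₀ K) j)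
    (hdisp : ∀ K, K₀ ≤ K → ∀ (j : ℕ) (g : Fin j → P),
      StepDisplaysAt (runsOf D g₀ K) j (carriersOf T 𝒮 (runsOf D g₀ K) K j g (Xs K j g)) c)
    (hclass : ∀ K, K₀ ≤ K → ∀ (j : ℕ) (g : Fin j → P) (p : P),
      ∀ x ∈ (𝒮.runPartial K (j + 1) (Fin.snoc g p)).histM.newPairs (j + 1),
        (Xs K j g).dC p x = (𝒮.κ K ((𝒮.runPartial K (j + 1) (Fin.snoc g p)).histM.newAt (j + 1) x) : ℝ))
    (hprepS : ∀ K, K₀ ≤ K → ∀ (j : ℕ) (g : Fin j → P) (p : P),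
      ∀ y ∈ (𝒮.runPartial K (j + 1) (Fin.snoc g p)).histM.rnwPairs (𝒮.runPartial K (j + 1) (Fin.snoc g p)).rnwM (j + 1),
        0 ≤ (Xs K j g).lfPrep p y ∧ (Xs K j g).lfPrep p y ≤ Real.exp (-(sRpin D O Lr p₁ g₀ 𝒮.R K j)))
    (hchain : ∀ K, K₀ ≤ K → ∀ (j : ℕ) (g : Fin j → P) (p : P),
      c.C' * (Xs K j g).volZΩ p + c.C380 * Real.log ((gsOf D g₀ K (j + 1)) ^ 2)⁻¹ * (Xs K j g).volZ p ≤
        uvolL cΛ M d (gsOf D g₀ K) (𝒮.R K) K (j + 1) *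
          ∑ cc ∈ (𝒮.runPartial K (j + 1) (Fin.snoc g p)).histM.comp (j + 1), ((cc.2).card : ℝ)) :
    HwPinned T 𝒮 (sBsharp (runsOf D g₀) c) (sRpin D O Lr p₁ g₀ 𝒮.R) cΛ M (gsOf D g₀) K₀ :=
  hw_of_stepDisplaysSharp_of_hvol D O Lr p₁ g₀ T 𝒮 c Xs cΛ M hc hM hℓ hdisp hclass hprepS
    (hvol_of_chain T 𝒮 (runsOf D g₀) c Xs cΛ M (gsOf D g₀) hdisp hchain)

end JunctionSharp

/-! ## §7 ERRATUM 2 (v1.3, RULING R-ne7bp1-g101-5) — §6 IS OVER-SHARP TOO; THE ROAD OF RECORD IS THE ROUNDED ONE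

**§6's `hw_of_stepDisplaysSharp_of_hvol` ∕ `hw_of_stepDisplaysSharp` (v1.2, kept byte-identical) display `hprepS`: EVERY preparatory
factor of a renewed part `≤ exp(−sRpin … K j)` = `exp(−S_j)`, the UNROUNDED CASE-2 exponent of [B16] p. 383 — AN OVER-SHARP DISPLAY
for Bałaban's operations; DO NOT CONSUME THEM EITHER.**  Located objection π-gapsne6-g4-2 (pub-balaban-gaps ne6 g4, journal l.48559),
UPHELD by the owner (journal l.48674) after a first-hand check of lit-balaban's PROVED transcription
`B16Sect1Statements.prep382_case1_factor`: print has FIVE preparatory factor kinds per component (pp. 381–383); CASE 1 (p. 382)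
yields only «exp(−A₁²48⁻²R_j⁻⁸p₁²(g_j)) ≦ exp(−R_j⁻⁸p₁²(g_j))», which EXCEEDS `exp(−S_j)` (`S_j ~ R_j^{−(d+2)(1+β₀)}`) for large
`R_j`.  The defect is the COUNT ROAD's: its END records pin the renewal credit at `S_h` (R-OWNER-47-1 (a); `HistReadDataLWL.hF`,
`TowerReadDataLWL.hw` at `sRunr`∕`sRpin`) — located owner finding F-ne7bp1-g101-2.  Print's uniform renewal letter is the ROUNDED one at
`t = d + 5`: «exp(−R_j^{−d−5}p₁²(g_j)) … the largest factor among all the small factors … we assume that 2p₁ − (d+5)r₀ > p₀» (p. 383).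
THE ROAD OF RECORD (owner, R-ne7bp1-g101-5) moves the END's letter, not print's: `Support/B16HistoryTowerEndDataLWR` (the record
`TowerReadDataLWR`, `hw` at `sRrnd := HistoryBankingSharpShares.sRsharp (O.d+5) 1 p₁`, census at `d+5`), `Support/B16HistoryTowerEndLWRP82`
(`toLP82R` via `HistoryBankingRoundingSupply.roundingRoomF_sharp_of_couplings` at `(t, Ap₁) := (d+5, 1)`;
`continuumYM4Torus_of_towerReadingLWR_fsc`) and `Support/B16HistoryTowerEndPrintedR` (`sRrnd_eq_sRsharp`: the rounded letter IS J4's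
`sRsharp` under the tables — an EQUALITY; `hw_of_stepDisplays_rounded` = J4 ∘ `HwPinned.of_le` at `le_of_eq`, NO letter moved).  What
stays useful in THIS file: §1 `runsOf`∕`flow_runsOf`, §4 `hsB_of_tables`, §5 `hwPinned_of_displays` (J4's junction at free letters). -/

end

end Summit.QuantumFields.BalabanUV.T4Continuum.B16HistoryTowerEndPrinted
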